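import Mathlib.Analysis.InnerProductSpace.PiL2
import Mathlib.MeasureTheory.Integral.Lebesgue.Basic
import Mathlib.MeasureTheory.Constructions.BorelSpace.Basic
import Mathlib.Topology.MetricSpace.ProperSpace
import HarnessLib

/-!
# Covering balls by finitely many unit balls: comparison of uniformly local quantities at two scales

Analysis/FluidPDE support file (theorems only). The uniformly local norms of Lemarié-Rieusset's
`L²_uloc` theory (*The Navier–Stokes Problem in the 21st Century* (2016), §14.1, p. 488:
"`sup_{x∈ℝᵈ} ∫_{|x-y|<1} |u₀(y)|² dy`") are insensitive, up to absolute constants, to the radius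
of the balls (Kang–Miura–Tsai 2021, remark after Def. 3.2: "balls of radius `R' > R` are finite
unions of balls of radius `R`"; Lemarié-Rieusset 2016, proof of Lemma 14.1, p. 489: the unit
cubes `Q_k = k + [0,1]³`). The tree's `ulocEnergy`, `ulocGradEnergyOn` and the estimates of the
proof of Thm. 14.7 are at unit scale, while a bump `φ₀(· - x₀)` of the family `𝓑` is supported
in a ball `B(x₀, R₀)`; this file provides the comparison:

* `exists_finset_ball_subset_iUnion_unit_ball` — for every radius `R` there is a finite set
  `s` of vectors such that *every* ball `B(x₀, R)` is covered by the unit balls `B(x₀ + y, 1)`,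
  `y ∈ s` (compactness of `B̄(0,R)` and translation);
* `exists_lintegral_ball_le_mul_iSup` — hence `∫_{B(x₀,R)} h ≤ N_R sup_y ∫_{B(y,1)} h` for every
  `h ≥ 0`, with `N_R` depending on `R` only;
* `exists_lintegral_cylinder_le_mul_iSup` — and the same for the space–time cylinders
  `I × B(x₀,R)` against `sup_y ∫∫_{I × B(y,1)}`.

Everything is stated on a finite-dimensional real normed space (proper, so closed balls are
compact) with an arbitrary measure; no measurability of `h` is needed (`lintegral_iUnion_le`).

## References

* P. G. Lemarié-Rieusset, *The Navier–Stokes Problem in the 21st Century*, CRC Press 2016,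
  §14.1, pp. 488–489. [LemarieRieusset2016]
* K. Kang, H. Miura, T.-P. Tsai, IMRN 2021 = arXiv:1812.10509, §3 (uniformly local spaces
  `L^q_{uloc,ρ}`). [KangMiuraTsai2020]
-/

noncomputable section

open MeasureTheory TopologicalSpace Set Function Filter Metric
open scoped ENNReal NNReal

namespace Literature.Analysis.FluidPDE

section Cover

variable {E : Type*} [NormedAddCommGroup E] [NormedSpace ℝ E] [FiniteDimensional ℝ E]

/-- **Every ball of radius `R` is covered by boundedly many unit balls, uniformly in the
centre**: there is a finite set `s ⊆ E` with `B(x₀, R) ⊆ ⋃_{y ∈ s} B(x₀ + y, 1)` for all `x₀`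
(cover the compact `B̄(0,R)` by unit balls centred at its points, extract a finite subcover, and
translate). [folklore] -/
theorem exists_finset_ball_subset_iUnion_unit_ball (R : ℝ) :
    ∃ s : Finset E, ∀ x₀ : E, ball x₀ R ⊆ ⋃ y ∈ s, ball (x₀ + y) 1 := by
  have hc : IsCompact (closedBall (0 : E) R) := isCompact_closedBall 0 R
  obtain ⟨s, hs⟩ := hc.elim_finite_subcover (fun y : E => ball y 1) (fun _ => isOpen_ball)
    (fun y hy => mem_iUnion.2 ⟨y, mem_ball_self one_pos⟩)
  refine ⟨s, fun x₀ x hx => ?_⟩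
  have hx' : x - x₀ ∈ closedBall (0 : E) R := by
    rw [mem_closedBall, dist_zero_right, ← dist_eq_norm]
    exact (mem_ball.1 hx).le
  obtain ⟨y, hy, hxy⟩ := mem_iUnion₂.1 (hs hx')
  refine mem_iUnion₂.2 ⟨y, hy, ?_⟩
  rw [mem_ball, dist_eq_norm] at hxy ⊢
  convert hxy using 2
  abel

end Cover

section Integrals

variable {E : Type*} [NormedAddCommGroup E] [NormedSpace ℝ E] [FiniteDimensional ℝ E]
  [MeasurableSpace E]

/-- Sums over a finite index type of terms bounded by `M` are at most `card • M`, in `ℝ≥0∞`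
multiplicative form. [folklore] -/
theorem tsum_fintype_le_card_mul {ι : Type*} [Fintype ι] {f : ι → ℝ≥0∞} {M : ℝ≥0∞}
    (h : ∀ i, f i ≤ M) : ∑' i, f i ≤ (Fintype.card ι : ℝ≥0∞) * M := by
  rw [tsum_fintype]
  calc ∑ i, f i ≤ ∑ _i : ι, M := Finset.sum_le_sum fun i _ => h i
    _ = (Fintype.card ι : ℝ≥0∞) * M := by
        rw [Finset.sum_const, Finset.card_univ, nsmul_eq_mul]

/-- **Ball integrals at scale `R` against the unit-scale supremum**: for every `R` there is a
constant `N` (the covering number of `exists_finset_ball_subset_iUnion_unit_ball`) such that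
`∫_{B(x₀,R)} h dμ ≤ N · sup_y ∫_{B(y,1)} h dμ` for every measure `μ`, every `h ≥ 0` and every
centre `x₀` (Lemarié-Rieusset 2016, §14.1: the `L^p_uloc` norms at different radii are
equivalent). [folklore] -/
theorem exists_lintegral_ball_le_mul_iSup (R : ℝ) :
    ∃ N : ℝ≥0, ∀ (μ : Measure E) (h : E → ℝ≥0∞) (x₀ : E),
      ∫⁻ x in ball x₀ R, h x ∂μ ≤ N * ⨆ y : E, ∫⁻ x in ball y 1, h x ∂μ := by
  obtain ⟨s, hs⟩ := exists_finset_ball_subset_iUnion_unit_ball (E := E) R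
  refine ⟨s.card, fun μ h x₀ => ?_⟩
  have hU : (⋃ y ∈ s, ball (x₀ + y) 1) = ⋃ y : s, ball (x₀ + (y : E)) 1 := by
    ext x
    simp only [mem_iUnion, Finset.exists_coe, exists_prop]
  calc ∫⁻ x in ball x₀ R, h x ∂μ ≤ ∫⁻ x in ⋃ y ∈ s, ball (x₀ + y) 1, h x ∂μ :=
        lintegral_mono_set (hs x₀)
    _ = ∫⁻ x in ⋃ y : s, ball (x₀ + (y : E)) 1, h x ∂μ := by rw [hU]
    _ ≤ ∑' y : s, ∫⁻ x in ball (x₀ + (y : E)) 1, h x ∂μ := lintegral_iUnion_le _ _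
    _ ≤ (Fintype.card s : ℝ≥0∞) * ⨆ y : E, ∫⁻ x in ball y 1, h x ∂μ :=
        tsum_fintype_le_card_mul fun y => le_iSup (fun y : E => ∫⁻ x in ball y 1, h x ∂μ) _
    _ = (s.card : ℝ≥0) * ⨆ y : E, ∫⁻ x in ball y 1, h x ∂μ := by
        rw [Fintype.card_coe]
        rfl

/-- **Cylinder integrals at scale `R` against the unit-scale supremum**: for every `R` there
is `N` such that `∫∫_{I × B(x₀,R)} g ≤ N · sup_y ∫∫_{I × B(y,1)} g` for every measure on `T × E`,
every time set `I`, every `g ≥ 0` and every centre `x₀`. [folklore] -/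
theorem exists_lintegral_cylinder_le_mul_iSup {T : Type*} [MeasurableSpace T] (R : ℝ) :
    ∃ N : ℝ≥0, ∀ (μ : Measure (T × E)) (I : Set T) (g : T × E → ℝ≥0∞) (x₀ : E),
      ∫⁻ z in I ×ˢ ball x₀ R, g z ∂μ ≤ N * ⨆ y : E, ∫⁻ z in I ×ˢ ball y 1, g z ∂μ := by
  obtain ⟨s, hs⟩ := exists_finset_ball_subset_iUnion_unit_ball (E := E) R
  refine ⟨s.card, fun μ I g x₀ => ?_⟩
  have hU : (I ×ˢ ⋃ y ∈ s, ball (x₀ + y) 1) = ⋃ y : s, I ×ˢ ball (x₀ + (y : E)) 1 := by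
    ext z
    simp only [mem_prod, mem_iUnion, Finset.exists_coe, exists_prop]
    constructor
    · rintro ⟨h1, y, hy, h2⟩
      exact ⟨y, hy, h1, h2⟩
    · rintro ⟨y, hy, h1, h2⟩
      exact ⟨h1, y, hy, h2⟩
  calc ∫⁻ z in I ×ˢ ball x₀ R, g z ∂μ ≤ ∫⁻ z in I ×ˢ ⋃ y ∈ s, ball (x₀ + y) 1, g z ∂μ :=
        lintegral_mono_set (prod_mono Subset.rfl (hs x₀))
    _ = ∫⁻ z in ⋃ y : s, I ×ˢ ball (x₀ + (y : E)) 1, g z ∂μ := by rw [hU]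
    _ ≤ ∑' y : s, ∫⁻ z in I ×ˢ ball (x₀ + (y : E)) 1, g z ∂μ := lintegral_iUnion_le _ _
    _ ≤ (Fintype.card s : ℝ≥0∞) * ⨆ y : E, ∫⁻ z in I ×ˢ ball y 1, g z ∂μ :=
        tsum_fintype_le_card_mul fun y => le_iSup (fun y : E => ∫⁻ z in I ×ˢ ball y 1, g z ∂μ) _
    _ = (s.card : ℝ≥0) * ⨆ y : E, ∫⁻ z in I ×ˢ ball y 1, g z ∂μ := by
        rw [Fintype.card_coe]
        rfl

end Integrals

end Literature.Analysis.FluidPDE
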